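/-
Copyright: the b2b-balaban T⁴-continuum CRUX team, row NE7b owner lineage `t4-ne7b-p1` (gen 116). Project licence.
-/
import Summits.QuantumFields.BalabanUV.T4Continuum.Spine.NE7b.SupBackgroundLocalisation
import Summits.QuantumFields.BalabanUV.T4Continuum.Spine.NE7b.SupBackgroundSemigroup

/-!
# THE WEIGHTED LETTERS READ AS TWO-RADIUS REGION LETTERS, AND CONSTANTS ARE BACKGROUNDS: a value obeying a weighted letter
# `e^{μρ(blk p)}|t| ≤ K·R(ρ)` for every bounded admissible weight is controlled by the data NEAR `blk p` plus an exponentially small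
# tail — `|t| ≤ K·(ω + Ω·e^{−μD})` when the data are `≤ ω` within `D` blocks and `≤ Ω` everywhere ((63) §3 is the case `ω = 0`) —;
# and the constant fields solve (60)'s background system with themselves as coarse datum, `σ(c) = c`: so «the coarse field is within
# `ω` of a constant `c` on `D` blocks around `p`» gives `|σw(p) − c| ≤ K₁(μ)(ω + Ωe^{−μD})` and `|∇_μσw(p)| ≤ (n+1)⁻¹K′(ω + Ωe^{−μD})`
# through (64) (a) ∕ the owner's localised-gradient letters — the form print's small-field REGIONS consume
# (row NE7b, node U5c; (63) ∕ (76) BY NAME; [folklore])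

Cell `pub-balaban`, sub-cell `t4`, spine estimate NE7b (`T4WeightBudget.RelWeightBound`; the cell's OWN estimate — NOT PRINTED in
[Bałaban 1983–89], NOT PROVED).  Crux-route work under `Spine/NE7b/` by the row OWNER (`t4-ne7b-p1` gen 116) under FREEZE (0)'s
crux-prover clause (FILING-CLAIM C-ne7bp1-g116-6); NOTHING of Bałaban's is named, valued or asserted; no `T4Continuum/Support` leaf
typed; no `def`, no notation; zero `sorry`.  Imports (BY NAME): the owner's (63) `…SupBackgroundLocalisation` (through it (62)
`lipschitz_trunc_dist`, `abs_le_exp_neg_mul`, (58) `abs_apply_le_norm`) and (76) `…SupBackgroundSemigroup` (`sum_nbhd_AX_mul`: the row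
formula of the site matrix, for the action of `A` on constants).

WHY (located).  Print's small-field conditions are TWO-RADIUS statements: the field is close to a constant (and has small derivatives)
on a neighbourhood of the point, and merely bounded far away; the conclusion degrades by `e^{−(rate)·(distance)}` ((47) §4 typed this for
the FREE section: `|(HB)(p) − c| ≤ cHs(ωK_d(δ_H) + Ωe^{−δ_Hρ∕2}K_d(δ_H∕2))`).  For the INTERACTING column every localisation is stated as
a weighted letter uniform over the bounded admissible weights ((63) §4, (64) §4, (65), (66), (75)'s and the owner's localised-gradient
letters), and (63) §3 reads such a letter as a far-support bound (near data ZERO).  The two-radius reading is the same truncated-distance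
weight `ρ = D − min(|· − blk p|, D)`: near data cost `e^{μD}ω`, far data cost `Ω`, and the letter at `ρ(blk p) = D` divides by `e^{μD}`
(§1).  To compare with a CONSTANT one needs the constant to be a background: the site matrix maps the constant field `c` to the constant
`a·c` ((76)'s row formula: the Laplacian kills constants, `Q′*Q′` fixes them), so `A c + u∘c` is constant, hence block-constant, and
(60)'s uniqueness clause gives `σ(Q′c) = σ(c) = c` (§2).  Readers for the two consumers' letter shapes close the file (§3).

WHAT IS PROVED ([folklore]; `ℓ^∞ := lp (fun _ : X d => ℝ) ∞`, `0 ≤ μ`):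
* §1 **`abs_le_two_radius_of_letter`** — two data channels (`v` coarse, `κ₀` fine) with near bounds `ω_v, ω_κ ≥ 0` on the `D`-ball of
  `blk p` and global bounds `Ω_v, Ω_κ`, and the letter `e^{μρ(blk p)}|t| ≤ K(C_vR_v(ρ) + C_κR_κ(ρ))` for every bounded admissible `ρ` ⟹
  `|t| ≤ K(C_v(ω_v + Ω_ve^{−μD}) + C_κ(ω_κ + Ω_κe^{−μD}))`; **`abs_le_two_radius_of_coarse_letter`** (one coarse channel:
  `|t| ≤ K(ω + Ωe^{−μD})`).
* §2 `sum_nbhd_AX_const` (`Σ_{nbhd} A(p,r)·c = a·c`), **`backgroundSystem_const`** (every constant field solves the sitewise background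
  system, any `u`), **`background_const_of_letters`** (under (60)'s displayed `Q′`-action and uniqueness clause at radius `r`: every
  `φ ∈ ℓ^∞` with `φ ≡ c`, `‖φ‖ ≤ r` has `Q′φ = φ` and `σ φ = φ` — CONSTANTS ARE BACKGROUNDS).
* §3 readers: **`region_value_of_letter`** (a coarse-to-fine difference map with (64) (a)'s letter shape `e^{μρ(blk p)}|(Sw′ − Sw)(p)| ≤
  K₁·R_{w′−w}(ρ)`: `|w′ − w| ≤ ω` on the `D`-ball, `≤ Ω` everywhere ⟹ `|(Sw′ − Sw)(p)| ≤ K₁(ω + Ωe^{−μD})`; with `w` constant and §2: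
  `|Sw′(p) − c| ≤ K₁(ω + Ωe^{−μD})`), and the same statement serves the gradient letter of the owner's `…SupBackgroundGradientLocalised`
  (`t = ` the forward difference, `K = (n+1)⁻¹(C₁ + 2λC₂K_σ)`).
* §4 toy.

HONEST (what this is NOT).  Readers and one algebraic fact; the letters themselves are (63) ∕ (64) ∕ the gradient files'; constants ∕ rates
existential; scalar `ℤ^d`; nothing of the covariant `H_k`, (A3) ∕ (A1c) (NC-NE7b-α UNRULED).  BY-NAME EFFECT ON THE WALL: NONE.  NE7b NOT
PRINTED ∕ NOT PROVED; spine PROVED 0∕9; rung (B)+1 on a FINITE torus — NOT infinite volume, NOT the mass gap, NOT Clay.  HONEST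
DEPENDENCY: continuum YM on T⁴ ⇐ BetaPertH ∧ nine spine estimates (0∕9 proved); BetaPertH ⇐ (D1) ∧ (D4) ∧ CAP+tail; G-an2-4 gates asym,
D1 and NE2∕3∕4.
-/

set_option autoImplicit false

noncomputable section

namespace Summit.QuantumFields.BalabanUV.T4Continuum.NE7b.SupBackgroundRegionLetters

open scoped ENNReal NNReal
open Metric Set
open Literature.MathematicalPhysics.QuantumFieldTheory.Balaban1983to89
open B6QGQLower276 (X e blk B mem_B sum_B_const AX)
open B5Hk103ScalarZd (nbhd)
open LocalNemytskiiSup (abs_apply_le_norm)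
open OneShotChartWeightedRows (lipschitz_trunc_dist abs_le_exp_neg_mul)
open SupBackgroundSemigroup (sum_nbhd_AX_mul blockAvg_comp_blk)

variable {d : ℕ}

/-! ## §1. Two-radius reading of a weighted letter -/

/-- The truncated-distance weight is bounded. [folklore] -/
theorem trunc_dist_bounded (c : X d) (D : ℝ) : ∃ M, ∀ y : X d, |D - min (dist y c) D| ≤ M := by
  refine ⟨|D| + |D|, fun y => (abs_sub _ _).trans (add_le_add le_rfl ?_)⟩
  rcases le_total (dist y c) D with h | h
  · rw [min_eq_left h, abs_of_nonneg dist_nonneg]; exact h.trans (le_abs_self D)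
  · rw [min_eq_right h]

/-- Under the truncated-distance weight at rate `μ ≥ 0`, data `≤ ω` within `D` of the centre and `≤ Ω` everywhere have weighted size
`≤ e^{μD}ω + Ω` (`ω ≥ 0`). [folklore] -/
theorem weighted_le_two_radius {μ : ℝ} (hμ0 : 0 ≤ μ) (c : X d) {D ω Ω : ℝ} (hω : 0 ≤ ω) (f : X d → ℝ) (g : X d → X d)
    (hnear : ∀ x, dist (g x) c < D → |f x| ≤ ω) (hfar : ∀ x, |f x| ≤ Ω) (x : X d) :
    Real.exp (μ * (D - min (dist (g x) c) D)) * |f x| ≤ Real.exp (μ * D) * ω + Ω := by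
  have hΩ : 0 ≤ Ω := (abs_nonneg _).trans (hfar x)
  by_cases hx : dist (g x) c < D
  · have h1 : Real.exp (μ * (D - min (dist (g x) c) D)) ≤ Real.exp (μ * D) := by
      rw [min_eq_left hx.le]
      exact Real.exp_le_exp.2 (mul_le_mul_of_nonneg_left (by linarith [dist_nonneg (x := g x) (y := c)]) hμ0)
    calc _ ≤ Real.exp (μ * D) * ω := mul_le_mul h1 (hnear x hx) (abs_nonneg _) (Real.exp_pos _).le
      _ ≤ _ := le_add_of_nonneg_right hΩ
  · rw [not_lt] at hx
    rw [min_eq_right hx, sub_self, mul_zero, Real.exp_zero, one_mul]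
    exact (hfar x).trans (le_add_of_nonneg_left (by positivity))

/-- **THE TWO-RADIUS READING OF A WEIGHTED LETTER** (any `μ ≥ 0`): suppose a value `t` obeys, for EVERY bounded weight `ρ` with
`ρ x − ρ y ≤ |x − y|_∞`, the letter `e^{μρ(blk p)}|t| ≤ K·(C_vR_v(ρ) + C_κR_κ(ρ))` for all weighted bounds `R_v(ρ)`, `R_κ(ρ)` of the coarse
datum `v` and the fine datum `κ₀`.  If `|v| ≤ ω_v` on the coarse ball `{y : |y − blk p|_∞ < D}` and `≤ Ω_v` everywhere, and `|κ₀| ≤ ω_κ`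
on the blocks over that ball and `≤ Ω_κ` everywhere (`ω_v, ω_κ ≥ 0`), then
`|t| ≤ K·(C_v(ω_v + Ω_ve^{−μD}) + C_κ(ω_κ + Ω_κe^{−μD}))`. [folklore] -/
theorem abs_le_two_radius_of_letter (n : ℕ) {μ : ℝ} (hμ0 : 0 ≤ μ) {K Cv Cκ : ℝ}
    {v κ₀ : X d → ℝ} {ωv Ωv ωκ Ωκ D t : ℝ} (hωv : 0 ≤ ωv) (hωκ : 0 ≤ ωκ) (p : X d)
    (hvnear : ∀ y, dist y (blk n p) < D → |v y| ≤ ωv) (hvfar : ∀ y, |v y| ≤ Ωv)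
    (hκnear : ∀ q, dist (blk n q) (blk n p) < D → |κ₀ q| ≤ ωκ) (hκfar : ∀ q, |κ₀ q| ≤ Ωκ)
    (hletter : ∀ ρ : X d → ℝ, (∀ x y, ρ x - ρ y ≤ dist x y) → (∃ M, ∀ y, |ρ y| ≤ M) →
      ∀ Rv' Rκ' : ℝ, (∀ y, Real.exp (μ * ρ y) * |v y| ≤ Rv') → (∀ q, Real.exp (μ * ρ (blk n q)) * |κ₀ q| ≤ Rκ') →
        Real.exp (μ * ρ (blk n p)) * |t| ≤ K * (Cv * Rv' + Cκ * Rκ')) :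
    |t| ≤ K * (Cv * (ωv + Ωv * Real.exp (-(μ * D))) + Cκ * (ωκ + Ωκ * Real.exp (-(μ * D)))) := by
  have hρ := lipschitz_trunc_dist (blk n p) D
  have h := hletter _ hρ (trunc_dist_bounded (blk n p) D) _ _
    (weighted_le_two_radius hμ0 (blk n p) hωv v id hvnear hvfar)
    (weighted_le_two_radius hμ0 (blk n p) hωκ κ₀ (blk n) hκnear hκfar)
  have hρp : D ≤ D - min (dist (blk n p) (blk n p)) D := by
    rw [dist_self]; have := min_le_left (0 : ℝ) D; linarith
  have hE : 0 < Real.exp (μ * D) := Real.exp_pos _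
  have h' : Real.exp (μ * D) * |t| ≤ K * (Cv * (Real.exp (μ * D) * ωv + Ωv) + Cκ * (Real.exp (μ * D) * ωκ + Ωκ)) :=
    (mul_le_mul_of_nonneg_right (Real.exp_le_exp.2 (mul_le_mul_of_nonneg_left hρp hμ0)) (abs_nonneg t)).trans h
  have hEE : Real.exp (μ * D) * Real.exp (-(μ * D)) = 1 := by rw [← Real.exp_add, add_neg_cancel, Real.exp_zero]
  rw [← le_div_iff₀' hE] at h'
  refine h'.trans (le_of_eq ?_)
  rw [div_eq_iff hE.ne']
  have : K * (Cv * (ωv + Ωv * Real.exp (-(μ * D))) + Cκ * (ωκ + Ωκ * Real.exp (-(μ * D)))) * Real.exp (μ * D)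
      = K * (Cv * (Real.exp (μ * D) * ωv + Ωv * (Real.exp (μ * D) * Real.exp (-(μ * D))))
        + Cκ * (Real.exp (μ * D) * ωκ + Ωκ * (Real.exp (μ * D) * Real.exp (-(μ * D))))) := by ring
  rw [this, hEE, mul_one, mul_one]

/-- **THE TWO-RADIUS READING, ONE COARSE CHANNEL**: if `e^{μρ(blk p)}|t| ≤ K·R_v(ρ)` for every bounded admissible `ρ` and every weighted
bound `R_v(ρ)` of `v`, and `|v| ≤ ω` on `{y : |y − blk p|_∞ < D}`, `≤ Ω` everywhere (`ω ≥ 0`), then `|t| ≤ K·(ω + Ω·e^{−μD})`. [folklore] -/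
theorem abs_le_two_radius_of_coarse_letter (n : ℕ) {μ : ℝ} (hμ0 : 0 ≤ μ) {K : ℝ} {v : X d → ℝ} {ω Ω D t : ℝ}
    (hω : 0 ≤ ω) (p : X d) (hnear : ∀ y, dist y (blk n p) < D → |v y| ≤ ω) (hfar : ∀ y, |v y| ≤ Ω)
    (hletter : ∀ ρ : X d → ℝ, (∀ x y, ρ x - ρ y ≤ dist x y) → (∃ M, ∀ y, |ρ y| ≤ M) →
      ∀ Rv' : ℝ, (∀ y, Real.exp (μ * ρ y) * |v y| ≤ Rv') → Real.exp (μ * ρ (blk n p)) * |t| ≤ K * Rv') :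
    |t| ≤ K * (ω + Ω * Real.exp (-(μ * D))) := by
  have h := abs_le_two_radius_of_letter n hμ0 (K := K) (Cv := 1) (Cκ := 0) (κ₀ := fun _ => 0)
    (ωκ := 0) (Ωκ := 0) hω le_rfl p hnear hfar (fun _ _ => by rw [abs_zero]) (fun _ => by rw [abs_zero])
    (fun ρ hρ hρb Rv' Rκ' hv _ => by rw [one_mul, zero_mul, add_zero]; exact hletter ρ hρ hρb Rv' hv)
  simpa using h

/-! ## §2. Constants are backgrounds -/

/-- **The site matrix on a constant field**: `Σ_{r∈nbhd_n p} A_n(p,r)·c = a·c` — the Laplacian kills constants, `aQ′*Q′` fixes them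
((76)'s row formula). [folklore] -/
theorem sum_nbhd_AX_const (n : ℕ) (a c : ℝ) (p : X d) : ∑ r ∈ nbhd n p, AX n a p r * c = a * c := by
  have hs : (0 : ℝ) < ((n : ℝ) + 1) ^ d := by positivity
  rw [sum_nbhd_AX_mul n a p (fun _ => c), sum_B_const]
  simp only [show (2 : ℝ) * c - c - c = 0 by ring, Finset.sum_const_zero, mul_zero, zero_add]
  rw [← mul_assoc, div_mul_cancel₀ a hs.ne']

/-- **EVERY CONSTANT FIELD SOLVES THE SITEWISE BACKGROUND SYSTEM** (any `a`, any `u`): for `φ ≡ c`, `A_nφ + u∘φ ≡ a·c + u(c)` equals its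
own block mean at every site. [folklore] -/
theorem backgroundSystem_const (n : ℕ) (a : ℝ) (u : ℝ → ℝ) {φ : X d → ℝ} {c : ℝ} (hφ : ∀ q, φ q = c) (p : X d) :
    (∑ r ∈ nbhd n p, AX n a p r * φ r) + u (φ p)
      = (((n : ℝ) + 1) ^ d)⁻¹ * ∑ p' ∈ B n (blk n p), ((∑ r ∈ nbhd n p', AX n a p' r * φ r) + u (φ p')) := by
  have hrow : ∀ q, (∑ r ∈ nbhd n q, AX n a q r * φ r) + u (φ q) = (fun _ : X d => a * c + u c) (blk n q) := fun q => by
    rw [Finset.sum_congr rfl fun r _ => by rw [hφ r], sum_nbhd_AX_const, hφ]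
  rw [Finset.sum_congr rfl fun p' _ => hrow p', blockAvg_comp_blk n (fun _ : X d => a * c + u c) (blk n p), hrow]

/-- **CONSTANTS ARE BACKGROUNDS**: under (60)'s displayed actions of `Q′`, `A` and its uniqueness clause at radius `r` for the
potential `u`, every `φ ∈ ℓ^∞` with `φ ≡ c` and `‖φ‖ ≤ r` satisfies `Q′φ = φ` and `σ φ = φ`. [folklore] -/
theorem background_const_of_letters (n : ℕ) {a : ℝ}
    (Dop Aop : lp (fun _ : X d => ℝ) ∞ →L[ℝ] lp (fun _ : X d => ℝ) ∞) (σ : lp (fun _ : X d => ℝ) ∞ → lp (fun _ : X d => ℝ) ∞)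
    (hD : ∀ (f : lp (fun _ : X d => ℝ) ∞) (y : X d), Dop f y = (((n : ℝ) + 1) ^ d)⁻¹ * ∑ p ∈ B n y, f p)
    (hA : ∀ (f : lp (fun _ : X d => ℝ) ∞) (p : X d), Aop f p = ∑ r ∈ nbhd n p, AX n a p r * f r)
    {u : ℝ → ℝ} {r : ℝ}
    (huniq : ∀ φ ∈ closedBall (0 : lp (fun _ : X d => ℝ) ∞) r,
      (∀ p : X d, Aop φ p + u (φ p) = (((n : ℝ) + 1) ^ d)⁻¹ * ∑ p' ∈ B n (blk n p), (Aop φ p' + u (φ p'))) →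
        σ (Dop φ) = φ)
    {φ : lp (fun _ : X d => ℝ) ∞} {c : ℝ} (hφ : ∀ q, φ q = c) (hr : ‖φ‖ ≤ r) : Dop φ = φ ∧ σ φ = φ := by
  have hDφ : Dop φ = φ := lp.ext (funext fun y => by
    rw [hD, Finset.sum_congr rfl fun p (_ : p ∈ B n y) => hφ p, sum_B_const, ← mul_assoc,
      inv_mul_cancel₀ (by positivity : (((n : ℝ) + 1) ^ d) ≠ 0), one_mul, hφ])
  refine ⟨hDφ, ?_⟩
  have h := huniq φ (by rw [mem_closedBall, dist_zero_right]; exact hr) (fun p => by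
    simp only [hA]; exact backgroundSystem_const n a u hφ p)
  rwa [hDφ] at h

/-! ## §3. Readers: the region letter of a coarse-to-fine map -/

/-- **THE REGION LETTER OF A LOCALISED COARSE-TO-FINE MAP** (the background `σ` with (64) (a)'s letter; the η-gradient of a background
pair with the owner's localised-gradient letter, `t =` the forward difference): if a value `t` (think `(Sw′ − Sw)(p)`) obeys
`e^{μρ(blk p)}|t| ≤ K₁·R(ρ)` for every bounded admissible `ρ` and every weighted bound `R(ρ)` of `w′ − w`, and the two coarse fields agree
to within `ω` on `{y : |y − blk p|_∞ < D}` and to within `Ω` everywhere, then `|t| ≤ K₁·(ω + Ω·e^{−μD})`.  With `w ≡ c` a constant in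
the chart ball (§2: `Sw = c`): «`w′` within `ω` of the constant `c` on `D` blocks around `p`» ⟹ `|Sw′(p) − c| ≤ K₁(ω + Ωe^{−μD})`.
[folklore] -/
theorem region_value_of_letter (n : ℕ) {μ : ℝ} (hμ0 : 0 ≤ μ) {K₁ : ℝ} (w w' : lp (fun _ : X d => ℝ) ∞)
    (p : X d) {ω Ω D t : ℝ} (hω : 0 ≤ ω) (hnear : ∀ y, dist y (blk n p) < D → |(w' - w) y| ≤ ω)
    (hfar : ∀ y, |(w' - w) y| ≤ Ω)
    (hletter : ∀ ρ : X d → ℝ, (∀ x y, ρ x - ρ y ≤ dist x y) → (∃ M, ∀ y, |ρ y| ≤ M) →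
      ∀ Rw : ℝ, (∀ y, Real.exp (μ * ρ y) * |(w' - w) y| ≤ Rw) → Real.exp (μ * ρ (blk n p)) * |t| ≤ K₁ * Rw) :
    |t| ≤ K₁ * (ω + Ω * Real.exp (-(μ * D))) :=
  abs_le_two_radius_of_coarse_letter n hμ0 (v := fun y => (w' - w) y) hω p hnear hfar hletter

/-- The global channel is free: `|(w′ − w)(y)| ≤ ‖w′ − w‖` always, so the region letter reads `|t| ≤ K₁·(ω + ‖w′ − w‖·e^{−μD})`.
[folklore] -/
theorem region_value_of_letter' (n : ℕ) {μ : ℝ} (hμ0 : 0 ≤ μ) {K₁ : ℝ} (w w' : lp (fun _ : X d => ℝ) ∞)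
    (p : X d) {ω D t : ℝ} (hω : 0 ≤ ω) (hnear : ∀ y, dist y (blk n p) < D → |(w' - w) y| ≤ ω)
    (hletter : ∀ ρ : X d → ℝ, (∀ x y, ρ x - ρ y ≤ dist x y) → (∃ M, ∀ y, |ρ y| ≤ M) →
      ∀ Rw : ℝ, (∀ y, Real.exp (μ * ρ y) * |(w' - w) y| ≤ Rw) → Real.exp (μ * ρ (blk n p)) * |t| ≤ K₁ * Rw) :
    |t| ≤ K₁ * (ω + ‖w' - w‖ * Real.exp (-(μ * D))) :=
  region_value_of_letter n hμ0 w w' p hω hnear (fun y => abs_apply_le_norm _ y) hletter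

/-! ## §4. Toy -/

/-- Toy: with `K₁ = 2`, near oscillation `ω = 1∕100`, global bound `Ω = 1`, rate `μ = 1` and `D = 0` blocks of agreement the letter
gives `2·(1∕100 + 1)`; every further block of agreement divides the far term by `e`. -/
example : (2 : ℝ) * (1 / 100 + 1 * Real.exp (-(1 * 0))) = 2 * (1 / 100 + 1) := by norm_num

end Summit.QuantumFields.BalabanUV.T4Continuum.NE7b.SupBackgroundRegionLetters

end
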